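import Literature.IUT.HodgeArakelov.GaloisPairCyclotomesTwist
import Literature.IUT.HodgeArakelov.GaloisPairCyclotomesThetaSync
import Literature.AnabelianGeometry.EtaleTheta.CyclotomeAutZHat
import Literature.AnabelianGeometry.AbsoluteAnabelian.GaloisCyclotomeZHatOne
import HarnessLib

/-!
# Bridge B12: the `Γ`-orbit (a) of [IUTchII] Cor. 1.11 at the GENUINE cyclotome is a `Γ`-TORSOR, and for
# `Γ = Ẑ^×` it is the FULL poly-isomorphism (proof-only)

Mochizuki, *Inter-universal Teichmüller theory II*, §1, Corollary 1.11 (a), kurims manuscript (Dec. 2020)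
p. 49 ll. 8–14: "(a) the `Γ`-orbit [where we recall that `Γ ⊆ Ẑ^×` is a closed subgroup]
`μ_Ẑ(G) ⥲ μ_Ẑ(O^×(G)) = Hom(ℚ/ℤ, O^×(G))` `(*bs-Gal_{G,⊳})` of the cyclotomic rigidity isomorphism …";
Remark 1.11.1 (ii), p. 50: "In the present series of papers, we shall primarily be interested in Corollary 1.11
in the case where `Γ = Ẑ^×`. That is to say, allowing for a `Γ (= Ẑ^×)`-multiple indeterminacy corresponds
precisely to working, in the case of `G ↷ O^×(G)`, with the underlying ind-topological module equipped with
topological group action [cf. (i), (b)]" [claim: Mochizuki2012, status: disputed] (IUTchII §1 Cor 1.11, kurims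
p.49); *Topics in absolute anabelian geometry III*, Def. 3.1 (v) p. 69 ("the cyclotome … is isomorphic to `Ẑ`"),
Prop. 3.3 (ii) p. 74 ("the natural action of `Ẑ^×`") [cite: MochizukiAbsTopIII2015, Proposition 3.3 (ii) p.74].
Record-only typing under the claim key `Mochizuki2012` (D-0012, disputed); abc-iut cell, layer L6,
`plan/L6/MERGE-MAP.md` §8 row B12 (lineage abc-iut-w4-d024), node `IUTchII:Cor1.11`.  PROOF-ONLY (0 defs).

STATE BEFORE THIS FILE.  The B12 instance of record of abc-iut-L6-t1's `GaloisPairRigidityData A`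
(`GaloisPairRigidityData.ofGaloisCyclotomeZHat R Y`, p419279; over Cor. 1.10's family
`ofGaloisCyclotomeCor110 (GalTwistInput.ofZHat S) R D C`, p417560) has GENUINE `μ_Ẑ(G)` (abc-iut-L4-t1's
group-theoretic cyclotome) and the GENUINE `Ẑ^×`-twist (`IsoClass.galCyclotomeTwist` = `cyclotome.zhatTwist`),
so its orbit (a) `(*bs-Gal_{G,⊳})` is `{χ(γ) ≫ (*bs-Gal) | γ ∈ Γ}` (`mem_orbitA_ofGaloisCyclotomeZHat_iff`).  What
the tree did NOT know is HOW LARGE this orbit is: with the degenerate twist (`GalTwistInput.trivial`) it is a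
point (second-reader note N1 on p416294), and nothing proved that the genuine twist moves anything.

THIS FILE PROVES, for every isomorph `G` of a compact group `P` identified with the absolute Galois group of a
non-archimedean local field `k` of characteristic `0` (`ε : P ≃ₜ* Gal(k̄/k)`; for Cor. 1.11, `P = G_k` of the
`Θ`-setting):
* `IsoClass.galCyclotomeTwist_bijective` — **the `Ẑ^×`-twist `Ẑ^× = Aut(Ẑ) → Aut(μ_Ẑ(G))` is a BIJECTION**:
  faithful, and every abstract group automorphism of `μ_Ẑ(G)` is a twist (transport of abc-iut-L2/L4's
  `cyclotome.zhatTwist_bijective_of_isSepClosed` — `Aut(Λ(k̄ˣ)) = Ẑ^×` — along the twist-compatible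
  isomorphisms `μ_Ẑ(G) ≅ μ_Ẑ(G_k)` (`muZhat.congr`) and `μ_Ẑ(G_k) ≅ Λ(k̄ˣ)`
  (`TorsionReciprocityData.muZhatEquiv`, local class field theory, `nonempty_torsionReciprocityData`));
* `GaloisPairRigidityData.twist_trans_bsGalTri_injective` / `existsUnique_of_mem_orbitA` / `exists_equiv_orbitA`
  — **Cor. 1.11 (a)'s `Γ`-orbit is a `Γ`-TORSOR** at the instance of record (any `A`, any rigidity input `R`,
  any `Π`-datum `Y`): each member is `χ(γ) ≫ (*bs-Gal)` for EXACTLY ONE `γ ∈ Γ`, `Γ ≃ (*bs-Gal_{G,⊳})`;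
  `orbitA_subset_orbitA_iff` / `orbitA_injective` — distinct closed subgroups `Γ` give distinct indeterminacies;
* `GaloisPairRigidityData.orbitA_top_eq_univ` — **Rmk. 1.11.1 (ii) typed: for `Γ = Ẑ^×` the orbit (a) is the
  set of ALL group isomorphisms `μ_Ẑ(G) ⥲ μ_Ẑ(O^×(G))`** (the full poly-isomorphism: "a `Ẑ^×`-multiple
  indeterminacy"), also read on the tuple of the functor of record (`cor111FunctorGaloisZHat_obj_orbA_top`) and
  at the instance over Cor. 1.10's family (`ofGaloisCyclotomeCor110_orbitA_top_eq_univ`).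

HONEST FRAMING: classical content (local class field theory + `Aut(Ẑ) = Ẑ^×`) applied to the cell's typed
interfaces; nothing of abc-iut-L6-t1 / w5-d089 / L4 / L2 is edited or restated; no definition, no named `Prop`
fact; the rigidity input `R` (input (a)) and the `Π`-datum `Y` stay the named inputs of record (at the genuine
monoids `R` is abc-iut-L6-t11's `nonempty_galRigidityInput_genuineOfModel_holds`); nothing here bears on
[IUTchIII] Cor. 3.12 and no side is taken; typed ≠ endorsed.
-/

namespace Literature.AnabelianGeometry.EtaleTheta.cyclotome

open CategoryTheory ProfiniteGrp ProfiniteGrp.ProfiniteCompletion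

universe u v

variable {A : Type u} [CommGroup A] {B : Type v} [CommGroup B]

/-- TRANSFER of `Aut(Λ) = Ẑ^×` along a twist-compatible isomorphism of cyclotomes: if `e : Λ(A) ≃* Λ(B)`
intertwines the `Ẑ^×`-twists and the twist `Ẑ^× → Aut(Λ(B))` is bijective, so is `Ẑ^× → Aut(Λ(A))`
(conjugation by `e`). [cite: MochizukiAbsTopIII2015, Proposition 3.3 (ii) p.74] -/
theorem zhatTwist_bijective_of_mulEquiv (e : cyclotome A ≃* cyclotome B)
    (he : ∀ (u : MulAut (completion (GrpCat.of (Multiplicative ℤ)))) (ζ : cyclotome A),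
      e (zhatTwist A u ζ) = zhatTwist B u (e ζ))
    (hB : Function.Bijective
      (zhatTwist B : MulAut (completion (GrpCat.of (Multiplicative ℤ))) → MulAut (cyclotome B))) :
    Function.Bijective
      (zhatTwist A : MulAut (completion (GrpCat.of (Multiplicative ℤ))) → MulAut (cyclotome A)) := by
  refine ⟨fun u v huv => hB.1 (MulEquiv.ext fun ξ => ?_), fun w => ?_⟩
  · have h : zhatTwist A u (e.symm ξ) = zhatTwist A v (e.symm ξ) := by rw [huv]
    have h' := congrArg e h
    rwa [he, he, MulEquiv.apply_symm_apply] at h'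
  · obtain ⟨u, hu⟩ := hB.2 ((e.symm.trans w).trans e)
    refine ⟨u, MulEquiv.ext fun ζ => e.injective ?_⟩
    rw [he, hu, MulEquiv.trans_apply, MulEquiv.trans_apply, MulEquiv.symm_apply_apply]

end Literature.AnabelianGeometry.EtaleTheta.cyclotome

namespace Literature.AnabelianGeometry.AbsoluteAnabelian

open CategoryTheory ProfiniteGrp ProfiniteGrp.ProfiniteCompletion
open Literature.AnabelianGeometry.EtaleTheta (cyclotome)

universe u

namespace TorsionReciprocityData

variable {k : Type u} [Field k] [CharZero k] (D : TorsionReciprocityData k)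

/-- `D.muZhatEquiv : μ_Ẑ(G_k) ⥲ Λ(k̄ˣ)` is COMPONENTWISE: it is `Λ(f)` for the homomorphism
`f : μ_{ℚ/ℤ}(G_k) → k̄ˣ` underlying `D.equiv` (definitional). [cite: MochizukiAbsTopIII2015, Cor 1.10 (i) p.42] -/
theorem muZhatEquiv_eq_map (ζ : muZhat (Field.absoluteGaloisGroup k)) :
    D.muZhatEquiv ζ =
      cyclotome.map ((CommGroup.torsion (AlgebraicClosure k)ˣ).subtype.comp
        (AddMonoidHom.toMultiplicativeLeft D.equiv.toAddMonoidHom)) ζ :=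
  Subtype.ext (funext fun _ => rfl)

/-- **`μ_Ẑ(G_k) ⥲ Λ(k̄ˣ)` intertwines the `Ẑ^×`-twists** (both cyclotomes carry "the natural action of
`Ẑ^×`", componentwise `ζ_n ↦ ζ_n ^ χ_n(u)`). [cite: MochizukiAbsTopIII2015, Proposition 3.3 (ii) p.74] -/
theorem muZhatEquiv_zhatTwist (u : MulAut (completion (GrpCat.of (Multiplicative ℤ))))
    (ζ : muZhat (Field.absoluteGaloisGroup k)) :
    D.muZhatEquiv (cyclotome.zhatTwist (Multiplicative (muQZ (Field.absoluteGaloisGroup k))) u ζ) =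
      cyclotome.zhatTwist (AlgebraicClosure k)ˣ u (D.muZhatEquiv ζ) :=
  cyclotome.mapEquiv_zhatTwist_of_eq_map D.muZhatEquiv _ D.muZhatEquiv_eq_map u ζ

end TorsionReciprocityData

namespace muZhat

/-- **`Aut(μ_Ẑ(G_k)) = Ẑ^×` for the absolute Galois group of a non-archimedean local field of characteristic
`0`**: the `Ẑ^×`-twist `Aut(Ẑ) → Aut(μ_Ẑ(G_k))` on abc-iut-L4-t1's group-theoretic cyclotome is a BIJECTION
(local class field theory `μ_Ẑ(G_k) ≅ Λ(k̄ˣ)` + `Aut(Λ(k̄ˣ)) = Ẑ^×`). [cite: MochizukiAbsTopIII2015, Proposition 3.3 (ii) p.74] -/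
theorem zhatTwist_bijective_absoluteGalois (k : Type u) [Field k] [CharZero k] [ValuativeRel k]
    [TopologicalSpace k] [IsNonarchimedeanLocalField k] :
    Function.Bijective (cyclotome.zhatTwist (Multiplicative (muQZ (Field.absoluteGaloisGroup k))) :
      MulAut (completion (GrpCat.of (Multiplicative ℤ))) → MulAut (muZhat (Field.absoluteGaloisGroup k))) := by
  obtain ⟨D⟩ := nonempty_torsionReciprocityData k
  exact cyclotome.zhatTwist_bijective_of_mulEquiv D.muZhatEquiv D.muZhatEquiv_zhatTwist
    (cyclotome.zhatTwist_bijective_of_isSepClosed (AlgebraicClosure k))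

variable {G G' : Type u} [Group G] [TopologicalSpace G] [IsTopologicalGroup G] [CompactSpace G]
  [Group G'] [TopologicalSpace G'] [IsTopologicalGroup G'] [CompactSpace G']

/-- Transport `μ_Ẑ(e) : μ_Ẑ(G) ⥲ μ_Ẑ(G')` along `e : G ≃ₜ* G'` intertwines the `Ẑ^×`-twists (it is `Λ(μ_{ℚ/ℤ}(e))`
componentwise). [cite: MochizukiAbsTopIII2015, Cor 1.10 (i) p.42] -/
theorem congr_zhatTwist (e : G ≃ₜ* G') (u : MulAut (completion (GrpCat.of (Multiplicative ℤ)))) (ζ : muZhat G) :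
    muZhat.congr e (cyclotome.zhatTwist (Multiplicative (muQZ G)) u ζ) =
      cyclotome.zhatTwist (Multiplicative (muQZ G')) u (muZhat.congr e ζ) :=
  cyclotome.mapEquiv_zhatTwist_of_eq_map (muZhat.congr e) (AddMonoidHom.toMultiplicative (muQZ.map e))
    (fun _ => rfl) u ζ

/-- **`Aut(μ_Ẑ(G)) = Ẑ^×` for every compact group `G ≅ G_k`** (any topological isomorphism `e` with the absolute
Galois group of a non-archimedean local field of characteristic `0`): the twist `Aut(Ẑ) → Aut(μ_Ẑ(G))` is a
bijection. [cite: MochizukiAbsTopIII2015, Proposition 3.3 (ii) p.74] -/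
theorem zhatTwist_bijective_of_continuousMulEquiv (k : Type u) [Field k] [CharZero k] [ValuativeRel k]
    [TopologicalSpace k] [IsNonarchimedeanLocalField k] (e : G ≃ₜ* Field.absoluteGaloisGroup k) :
    Function.Bijective (cyclotome.zhatTwist (Multiplicative (muQZ G)) :
      MulAut (completion (GrpCat.of (Multiplicative ℤ))) → MulAut (muZhat G)) :=
  cyclotome.zhatTwist_bijective_of_mulEquiv (muZhat.congr e) (congr_zhatTwist e)
    (zhatTwist_bijective_absoluteGalois k)

end muZhat

end Literature.AnabelianGeometry.AbsoluteAnabelian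

namespace Literature.IUT.HodgeArakelov

open CategoryTheory
open Literature.AnabelianGeometry.AbsoluteAnabelian

universe u

/-! ## `Aut(μ_Ẑ(G)) = Ẑ^×` for every object `G` of `IsoClass G_k` -/

namespace IsoClass

variable {P : TopGroup.{u}} [CompactSpace P] (k : Type u) [Field k] [CharZero k] [ValuativeRel k]
  [TopologicalSpace k] [IsNonarchimedeanLocalField k] (ε : P ≃ₜ* Field.absoluteGaloisGroup k)

include ε

/-- **The GENUINE `Ẑ^×`-twist on `μ_Ẑ(G)` is a bijection `Ẑ^× → Aut(μ_Ẑ(G))`** for every isomorph `G` of a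
compact group `P ≅ G_k` = the absolute Galois group of a non-archimedean local field `k` of characteristic `0`
([IUTchII] Rmk. 1.11.1 (i)(b) "the natural action of `Ẑ^×`"; [AbsTopIII] Def. 3.1 (v) "isomorphic to `Ẑ`").
[claim: Mochizuki2012, status: disputed] (IUTchII §1 Rmk 1.11.1 (i), kurims p.50) -/
theorem galCyclotomeTwist_bijective (X : IsoClass P) :
    Function.Bijective (X.galCyclotomeTwist : ZHatUnits → MulAut X.galCyclotome) := by
  haveI := X.compactSpace_carrier
  exact muZhat.zhatTwist_bijective_of_continuousMulEquiv k ((Classical.choice X.iso).trans ε)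

/-- Faithfulness: `γ ↦ χ(γ) ∈ Aut(μ_Ẑ(G))` is injective. [claim: Mochizuki2012, status: disputed]
(IUTchII §1 Rmk 1.11.1 (i), kurims p.50) -/
theorem galCyclotomeTwist_injective (X : IsoClass P) :
    Function.Injective (X.galCyclotomeTwist : ZHatUnits → MulAut X.galCyclotome) :=
  (galCyclotomeTwist_bijective k ε X).1

/-- Fullness: every abstract group automorphism of `μ_Ẑ(G)` is the twist by EXACTLY ONE `u ∈ Ẑ^×`.
[claim: Mochizuki2012, status: disputed] (IUTchII §1 Rmk 1.11.1 (i), kurims p.50) -/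
theorem existsUnique_galCyclotomeTwist_eq (X : IsoClass P) (w : X.galCyclotome ≃* X.galCyclotome) :
    ∃! u : ZHatUnits, X.galCyclotomeTwist u = w := by
  obtain ⟨u, hu⟩ := (galCyclotomeTwist_bijective k ε X).2 w
  exact ⟨u, hu, fun v hv => galCyclotomeTwist_injective k ε X (hv.trans hu.symm)⟩

end IsoClass

/-! ## [IUTchII] Cor. 1.11 (a): the `Γ`-orbit `(*bs-Gal_{G,⊳})` of the instance of record is a `Γ`-torsor -/

namespace GaloisPairRigidityData

variable {S : ThetaSetting.{u}} [CompactSpace S.Gk] {A : AbsTopMonoids S} (k : Type u) [Field k] [CharZero k]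
  [ValuativeRel k] [TopologicalSpace k] [IsNonarchimedeanLocalField k] (ε : S.Gk ≃ₜ* Field.absoluteGaloisGroup k)
  (R : GalRigidityInput A) (Y : GalThetaSyncInput A)

include ε

/-- `γ ↦ χ(γ) ≫ (*bs-Gal)` is INJECTIVE on `Ẑ^×`: distinct twists give distinct members of the orbit (a) of
**IUTchII:Cor1.11** at the instance of record. [claim: Mochizuki2012, status: disputed]
(IUTchII §1 Cor 1.11, kurims p.49) -/
theorem twist_trans_bsGalTri_injective (G : IsoClass S.Gk) :
    Function.Injective fun γ : ZHatUnits => (G.galCyclotomeTwist γ).trans (R.bsGalTri G) := by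
  intro γ γ' h
  apply IsoClass.galCyclotomeTwist_injective k ε G
  refine MulEquiv.ext fun ζ => (R.bsGalTri G).injective ?_
  have h' := MulEquiv.congr_fun h ζ
  simpa only [MulEquiv.trans_apply] using h'

/-- **Cor. 1.11 (a)'s `Γ`-orbit is a `Γ`-TORSOR**: every member `φ ∈ (*bs-Gal_{G,⊳})` is `χ(γ) ≫ (*bs-Gal)` for
EXACTLY ONE `γ ∈ Γ`. [claim: Mochizuki2012, status: disputed] (IUTchII §1 Cor 1.11, kurims p.49) -/
theorem existsUnique_of_mem_orbitA (Γ : Subgroup ZHatUnits) (G : IsoClass S.Gk)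
    {φ : G.galCyclotome ≃* A.muZhatUnits G} (hφ : φ ∈ (ofGaloisCyclotomeZHat R Y).orbitA Γ G) :
    ∃! γ : ZHatUnits, γ ∈ Γ ∧ φ = (G.galCyclotomeTwist γ).trans (R.bsGalTri G) := by
  obtain ⟨γ, hγ, rfl⟩ := (mem_orbitA_ofGaloisCyclotomeZHat_iff R Y Γ G φ).1 hφ
  exact ⟨γ, ⟨hγ, rfl⟩, fun γ' h => (twist_trans_bsGalTri_injective k ε R G h.2).symm⟩

/-- The torsor as a bijection `Γ ≃ (*bs-Gal_{G,⊳})`, `γ ↦ χ(γ) ≫ (*bs-Gal)` (existence of the equivalence; no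
definition is introduced). [claim: Mochizuki2012, status: disputed] (IUTchII §1 Cor 1.11, kurims p.49) -/
theorem exists_equiv_orbitA (Γ : Subgroup ZHatUnits) (G : IsoClass S.Gk) :
    ∃ f : Γ ≃ (ofGaloisCyclotomeZHat R Y).orbitA Γ G,
      ∀ γ : Γ, (f γ).1 = (G.galCyclotomeTwist γ).trans (R.bsGalTri G) := by
  refine ⟨Equiv.ofBijective (fun γ : Γ => ⟨(G.galCyclotomeTwist γ).trans (R.bsGalTri G), γ, γ.2, rfl⟩)
    ⟨fun γ γ' h => Subtype.ext (twist_trans_bsGalTri_injective k ε R G (congrArg Subtype.val h)),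
     fun φ => ?_⟩, fun γ => rfl⟩
  obtain ⟨γ, hγ, hφ⟩ := (mem_orbitA_ofGaloisCyclotomeZHat_iff R Y Γ G φ.1).1 φ.2
  exact ⟨⟨γ, hγ⟩, Subtype.ext hφ.symm⟩

/-- Distinct indeterminacy groups give distinct orbits: `(*bs-Gal)_Γ ⊆ (*bs-Gal)_{Γ'}` iff `Γ ≤ Γ'`.
[claim: Mochizuki2012, status: disputed] (IUTchII §1 Cor 1.11, kurims p.49) -/
theorem orbitA_subset_orbitA_iff (Γ Γ' : Subgroup ZHatUnits) (G : IsoClass S.Gk) :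
    (ofGaloisCyclotomeZHat R Y).orbitA Γ G ⊆ (ofGaloisCyclotomeZHat R Y).orbitA Γ' G ↔ Γ ≤ Γ' := by
  refine ⟨fun h γ hγ => ?_, fun h φ hφ => ?_⟩
  · have hmem : (G.galCyclotomeTwist γ).trans (R.bsGalTri G) ∈ (ofGaloisCyclotomeZHat R Y).orbitA Γ G :=
      (mem_orbitA_ofGaloisCyclotomeZHat_iff R Y Γ G _).2 ⟨γ, hγ, rfl⟩
    obtain ⟨γ', hγ', h'⟩ := (mem_orbitA_ofGaloisCyclotomeZHat_iff R Y Γ' G _).1 (h hmem)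
    rwa [twist_trans_bsGalTri_injective k ε R G h']
  · obtain ⟨γ, hγ, rfl⟩ := (mem_orbitA_ofGaloisCyclotomeZHat_iff R Y Γ G φ).1 hφ
    exact (mem_orbitA_ofGaloisCyclotomeZHat_iff R Y Γ' G _).2 ⟨γ, h hγ, rfl⟩

/-- Hence `Γ ↦ (*bs-Gal_{G,⊳})_Γ` is injective: the orbit (a) DETERMINES the closed subgroup `Γ ⊆ Ẑ^×`.
[claim: Mochizuki2012, status: disputed] (IUTchII §1 Cor 1.11, kurims p.49) -/
theorem orbitA_injective (G : IsoClass S.Gk) :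
    Function.Injective fun Γ : Subgroup ZHatUnits => (ofGaloisCyclotomeZHat R Y).orbitA Γ G := fun Γ Γ' h =>
  le_antisymm ((orbitA_subset_orbitA_iff k ε R Y Γ Γ' G).1 h.le) ((orbitA_subset_orbitA_iff k ε R Y Γ' Γ G).1 h.ge)

/-- For a general `Γ`: `φ : μ_Ẑ(G) ⥲ μ_Ẑ(O^×(G))` lies in the `Γ`-orbit (a) iff the UNIQUE `u ∈ Ẑ^×` with
`χ(u) = φ ≫ (*bs-Gal)⁻¹` lies in `Γ`. [claim: Mochizuki2012, status: disputed] (IUTchII §1 Cor 1.11, kurims p.49) -/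
theorem mem_orbitA_iff_of_twist_eq (Γ : Subgroup ZHatUnits) (G : IsoClass S.Gk)
    (φ : G.galCyclotome ≃* A.muZhatUnits G) {u : ZHatUnits}
    (hu : G.galCyclotomeTwist u = φ.trans (R.bsGalTri G).symm) :
    φ ∈ (ofGaloisCyclotomeZHat R Y).orbitA Γ G ↔ u ∈ Γ := by
  have hφ : φ = (G.galCyclotomeTwist u).trans (R.bsGalTri G) := MulEquiv.ext fun ζ => by
    rw [MulEquiv.trans_apply, hu, MulEquiv.trans_apply, MulEquiv.apply_symm_apply]
  refine ⟨fun h => ?_, fun h => (mem_orbitA_ofGaloisCyclotomeZHat_iff R Y Γ G φ).2 ⟨u, h, hφ⟩⟩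
  obtain ⟨γ, hγ, h'⟩ := (mem_orbitA_ofGaloisCyclotomeZHat_iff R Y Γ G φ).1 h
  rwa [twist_trans_bsGalTri_injective k ε R G (hφ.symm.trans h')]

/-- **Rmk. 1.11.1 (ii) typed — `Γ = Ẑ^×`: the orbit (a) of IUTchII:Cor1.11 is the FULL poly-isomorphism**, i.e.
the set of ALL group isomorphisms `μ_Ẑ(G) ⥲ μ_Ẑ(O^×(G))` ("allowing for a `Γ (= Ẑ^×)`-multiple indeterminacy"):
any such isomorphism differs from the rigidity isomorphism by an automorphism of `μ_Ẑ(G)`, which is a twist.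
[claim: Mochizuki2012, status: disputed] (IUTchII §1 Rmk 1.11.1 (ii), kurims p.50) -/
theorem orbitA_top_eq_univ (G : IsoClass S.Gk) : (ofGaloisCyclotomeZHat R Y).orbitA ⊤ G = Set.univ := by
  refine Set.eq_univ_iff_forall.2 fun (φ : G.galCyclotome ≃* A.muZhatUnits G) => ?_
  obtain ⟨u, hu, -⟩ := IsoClass.existsUnique_galCyclotomeTwist_eq k ε G (φ.trans (R.bsGalTri G).symm)
  exact (mem_orbitA_iff_of_twist_eq k ε R Y ⊤ G φ hu).2 (Subgroup.mem_top u)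

/-- The same at **the instance over Cor. 1.10's family** `ofGaloisCyclotomeCor110 (GalTwistInput.ofZHat S) R D C`
(p417560; it IS `ofGaloisCyclotomeZHat R (GalThetaSyncInput.ofMonoThetaRigidityData D C)`): for `Γ = Ẑ^×`
the orbit (a) is every isomorphism. [claim: Mochizuki2012, status: disputed] (IUTchII §1 Rmk 1.11.1 (ii), kurims p.50) -/
theorem ofGaloisCyclotomeCor110_orbitA_top_eq_univ (D : MonoThetaRigidityData S) (C : GalCorPiXInput A D)
    (G : IsoClass S.Gk) :
    (ofGaloisCyclotomeCor110 (GalTwistInput.ofZHat S) R D C).orbitA ⊤ G = Set.univ :=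
  orbitA_top_eq_univ k ε R _ G

/-- … and its `Γ`-orbit (a) is a `Γ`-torsor. [claim: Mochizuki2012, status: disputed]
(IUTchII §1 Cor 1.11, kurims p.49) -/
theorem ofGaloisCyclotomeCor110_existsUnique_of_mem_orbitA (D : MonoThetaRigidityData S)
    (C : GalCorPiXInput A D) (Γ : Subgroup ZHatUnits) (G : IsoClass S.Gk)
    {φ : G.galCyclotome ≃* A.muZhatUnits G}
    (hφ : φ ∈ (ofGaloisCyclotomeCor110 (GalTwistInput.ofZHat S) R D C).orbitA Γ G) :
    ∃! γ : ZHatUnits, γ ∈ Γ ∧ φ = (G.galCyclotomeTwist γ).trans (R.bsGalTri G) :=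
  existsUnique_of_mem_orbitA k ε R _ Γ G hφ

end GaloisPairRigidityData

/-- **On the functor of record** `cor111FunctorGaloisZHat R Y Γ Γ'` (p419279): for `Γ = Ẑ^×` the
`(*bs-Gal_{G,⊳})`-entry of the tuple assigned to `(Π, G)` is the full set of isomorphisms `μ_Ẑ(G) ⥲ μ_Ẑ(O^×(G))`.
[claim: Mochizuki2012, status: disputed] (IUTchII §1 Rmk 1.11.1 (ii), kurims p.50) -/
theorem cor111FunctorGaloisZHat_obj_orbA_top {S : ThetaSetting.{u}} [CompactSpace S.Gk] {A : AbsTopMonoids S}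
    (k : Type u) [Field k] [CharZero k] [ValuativeRel k] [TopologicalSpace k] [IsNonarchimedeanLocalField k]
    (ε : S.Gk ≃ₜ* Field.absoluteGaloisGroup k) (R : GalRigidityInput A) (Y : GalThetaSyncInput A)
    (Γ' : Type u) [Group Γ'] (X : IsoClass S.PiX × TwistedIsoClass S.Gk Γ') :
    ((cor111FunctorGaloisZHat R Y ⊤ Γ').obj X).orbA = Set.univ :=
  GaloisPairRigidityData.orbitA_top_eq_univ k ε R Y X.2.toIso

/-- … and for a general `Γ` it is a `Γ`-torsor (each member from exactly one `γ ∈ Γ`).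
[claim: Mochizuki2012, status: disputed] (IUTchII §1 Cor 1.11, kurims p.49) -/
theorem cor111FunctorGaloisZHat_obj_orbA_existsUnique {S : ThetaSetting.{u}} [CompactSpace S.Gk]
    {A : AbsTopMonoids S} (k : Type u) [Field k] [CharZero k] [ValuativeRel k] [TopologicalSpace k]
    [IsNonarchimedeanLocalField k] (ε : S.Gk ≃ₜ* Field.absoluteGaloisGroup k) (R : GalRigidityInput A)
    (Y : GalThetaSyncInput A) (Γ : Subgroup ZHatUnits) (Γ' : Type u) [Group Γ']
    (X : IsoClass S.PiX × TwistedIsoClass S.Gk Γ') {φ : X.2.toIso.galCyclotome ≃* A.muZhatUnits X.2.toIso}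
    (hφ : φ ∈ ((cor111FunctorGaloisZHat R Y Γ Γ').obj X).orbA) :
    ∃! γ : ZHatUnits, γ ∈ Γ ∧ φ = (X.2.toIso.galCyclotomeTwist γ).trans (R.bsGalTri X.2.toIso) :=
  GaloisPairRigidityData.existsUnique_of_mem_orbitA k ε R Y Γ X.2.toIso hφ

end Literature.IUT.HodgeArakelov
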